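import Summits.ValiantsHypothesis.ValiantsHypothesis.Theorems.KPlusLogSqLawTropicalStaticMountainCounts

/-!
# Route «KPlusLogSqLaw» — the static family MOUNTAIN, part 3: the hull and the cost lower bound

HONEST FRAMING.  Helper chain of the object-search cell `pub-symmetroid` (seat val-sym-lift-p1 g5, 2026-08-27) toward
the cruxes `WeakLifting` (ledger item `stmt-ValiantsHypothesis-19561`) / `TropicalB` (`stmt-ValiantsHypothesis-19771`) of
route `KPlusLogSqLaw`, in the vocabulary of `…CensusTropicalKLaw` / `…CensusTropicalKLawStatic` (`TropRootLawAt`,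
`TropRootLawAtStatic`, `IsStatic`, `IsDominant`, `termSign`, `tropWeight`).  It is a statement of FINITE TROPICAL
COMBINATORICS (an explicit dominance design per format `(m, 3)` and its chain); nothing here asserts or bears on `TropicalB`,
`WeakLifting`, `Lifting`, `KPlusLogSqLaw`, the cell's real census or registers (DoorA26 / DoorA34), `MatrixDescartes`
(`stmt-ValiantsHypothesis-18050`) or `VP ≠ VNP`.

Proved here (sorry-free):
* subset sums: a monotone `f` summed over a `t`-subset of `ℕ` is at least `f 0 + ⋯ + f (t−1)`, and at least
  `f 0 + ⋯ + f (t−2) + f t` unless the subset is `{0,…,t−1}` (`sum_range_card_le`, `sum_range_card_le'`);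
* THE HULL (`hull`): the points `(Dg(y,z), W(y,z))` of the admissible grid (and the origin) are in strictly convex position
  along the lexicographic order and `θ(y,z) = Q^z y − 1` supports exactly `(y,z)`:
  `θ(y,z)·Dg(y',z') − W(y',z') < θ(y,z)·Dg(y,z) − W(y,z)` for `(y',z') ≠ (y,z)` (three cases `z' <, =, > z`);
* THE COST LOWER BOUND (`cost_ge_land`): `cost σ ≥ c0 σ + ∑ over landing rows a of Q^a (Q−1)`, and the two numerical
  comparisons `boundA` / `boundB` against `W(·, z)` used in the case analysis of part 4.
-/

-- `Summit.ValiantsHypothesis.ValiantsHypothesis.…` repeats a component by the D-0017 layout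
-- (single-conjunct summit), which the `dupNamespace` linter flags; the name is mandated.
set_option linter.dupNamespace false
set_option autoImplicit false

namespace Summit.ValiantsHypothesis.ValiantsHypothesis.Theorems.LacunarySymmetroidMatrixDescartes.TropicalCensus

open Summit.ValiantsHypothesis.ValiantsHypothesis.Theorems.MatrixDescartes.Negative
open scoped BigOperators
open Finset

namespace Mountain

variable (n : ℕ)

/-- the sum of a monotone `f` over a `t`-element set of naturals is at least `f 0 + ⋯ + f (t−1)`. -/
theorem sum_range_card_le (f : ℕ → ℤ) (hf : Monotone f) (L : Finset ℕ) :
    ∑ a ∈ range L.card, f a ≤ ∑ a ∈ L, f a := by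
  induction L using Finset.induction_on_max with
  | empty => simp
  | insert a s has ih =>
    have ha : a ∉ s := fun h => lt_irrefl a (has a h)
    rw [Finset.sum_insert ha, Finset.card_insert_of_notMem ha, Finset.sum_range_succ]
    have hcard : s.card ≤ a := by
      have hsub : s ⊆ Finset.range a := fun x hx => Finset.mem_range.mpr (has x hx)
      simpa using Finset.card_le_card hsub
    have := hf hcard
    linarith

/-- a `t`-element set of naturals other than `{0, …, t−1}` has maximum `≥ t`. -/
theorem card_le_max' (L : Finset ℕ) (hL : L.Nonempty) (hne : L ≠ range L.card) : L.card ≤ L.max' hL := by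
  by_contra h
  push Not at h
  apply hne
  apply Finset.eq_of_subset_of_card_le
  · intro x hx
    exact Finset.mem_range.mpr (lt_of_le_of_lt (Finset.le_max' L x hx) h)
  · simp

/-- … so the refined bound: its `f`-sum is at least `f 0 + ⋯ + f (t−2) + f t`. -/
theorem sum_range_card_le' (f : ℕ → ℤ) (hf : Monotone f) (L : Finset ℕ) (hL : L.Nonempty)
    (hne : L ≠ range L.card) : ∑ a ∈ range (L.card - 1), f a + f L.card ≤ ∑ a ∈ L, f a := by
  have haL : L.max' hL ∈ L := Finset.max'_mem L hL
  rw [← Finset.add_sum_erase L f haL]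
  have hcard : (L.erase (L.max' hL)).card = L.card - 1 := Finset.card_erase_of_mem haL
  have h1 := sum_range_card_le f hf (L.erase (L.max' hL))
  rw [hcard] at h1
  have h2 : f L.card ≤ f (L.max' hL) := hf (card_le_max' L hL hne)
  linarith

/-- `2·C(y,2) = y(y−1)`. -/
theorem two_mul_choose_two (y : ℕ) : 2 * ((y.choose 2 : ℕ) : ℤ) = (y : ℤ) * ((y : ℤ) - 1) := by
  induction y with
  | zero => simp
  | succ y ih =>
    rw [Nat.choose_succ_succ', Nat.choose_one_right]
    push_cast
    linarith

/-- `W ≥ 0`. -/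
theorem Wv_nonneg (y z : ℕ) : 0 ≤ Wv n y z := by
  unfold Wv
  split_ifs with hz
  · exact le_rfl
  · have h1 := Q_pow_mono n (show 1 ≤ z by omega)
    rw [pow_one] at h1
    have h2 := Q_pow_pos n z
    have h3 : (0 : ℤ) ≤ ((y.choose 2 : ℕ) : ℤ) := by positivity
    have h4 := one_le_Q n
    nlinarith

/-- `k·Q ≤ Q^k` for `k ≥ 1`. -/
theorem mul_Q_le_pow (k : ℕ) (hk : 1 ≤ k) : (k : ℤ) * Q n ≤ Q n ^ k := by
  induction k with
  | zero => omega
  | succ k ih =>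
    rcases Nat.eq_zero_or_pos k with rfl | hk'
    · simp
    · have ih' := ih hk'
      have hQ := eight_le_Q n
      have hk1 : (1 : ℤ) ≤ k := by exact_mod_cast hk'
      rw [pow_succ]
      push_cast
      nlinarith [Q_pow_pos n k]

/-- hull inequality, same block (`z' = z ≥ 1`, `y' ≠ y`). -/
theorem hull_same (y y' z : ℕ) (hz : 1 ≤ z) (hne : y' ≠ y) :
    th n y z * (Dg n y' z - Dg n y z) < Wv n y' z - Wv n y z := by
  unfold th Dg Wv
  rw [if_neg (by omega), if_neg (by omega)]
  have hP : 8 ≤ Q n ^ z := by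
    have := Q_pow_mono n hz; rw [pow_one] at this; linarith [eight_le_Q n]
  have c1 := two_mul_choose_two y
  have c2 := two_mul_choose_two y'
  -- 2·(RHS − LHS) = (y' − y)·(Q^z (y' − y − 1) + 2)
  have key : 2 * ((2 * Q n ^ z - Q n - 1 + Q n ^ z * ((y'.choose 2 : ℕ) : ℤ)) -
      (2 * Q n ^ z - Q n - 1 + Q n ^ z * ((y.choose 2 : ℕ) : ℤ)) -
      (Q n ^ z * (y : ℤ) - 1) * (((y' : ℤ) + ((n : ℤ) + 3) * z) - ((y : ℤ) + ((n : ℤ) + 3) * z))) =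
      ((y' : ℤ) - y) * (Q n ^ z * ((y' : ℤ) - y - 1) + 2) := by
    linear_combination (Q n ^ z) * c2 - (Q n ^ z) * c1
  rcases lt_or_gt_of_ne hne with hlt | hgt
  · have h1 : (y' : ℤ) - y ≤ -1 := by
      have : (y' : ℤ) < y := by exact_mod_cast hlt
      linarith
    have h2 : Q n ^ z * ((y' : ℤ) - y - 1) + 2 < 0 := by nlinarith
    nlinarith
  · have h1 : 1 ≤ (y' : ℤ) - y := by
      have : (y : ℤ) < y' := by exact_mod_cast hgt
      linarith
    have h2 : 0 < Q n ^ z * ((y' : ℤ) - y - 1) + 2 := by nlinarith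
    nlinarith

/-- hull inequality, later block (`z' > z`). -/
theorem hull_up (y z y' z' : ℕ) (h : (y = 0 ∧ z = 0) ∨ (1 ≤ y ∧ 1 ≤ z ∧ y + z ≤ n + 1))
    (h' : 1 ≤ y' ∧ 1 ≤ z' ∧ y' + z' ≤ n + 1) (hzz : z < z') :
    th n y z * (Dg n y' z' - Dg n y z) < Wv n y' z' - Wv n y z := by
  have hW' : 0 < Wv n y' z' := by
    unfold Wv; rw [if_neg (by omega)]
    have h1 := Q_pow_mono n (show 1 ≤ z' by omega)
    rw [pow_one] at h1
    have h3 : (0 : ℤ) ≤ ((y'.choose 2 : ℕ) : ℤ) := by positivity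
    nlinarith [Q_pow_pos n z', eight_le_Q n]
  rcases h with ⟨rfl, rfl⟩ | h
  · -- the identity as reference point: `θ = −1`, `Dg = 0`, `W = 0`
    unfold th Dg
    have : Wv n 0 0 = 0 := by unfold Wv; rw [if_pos rfl]
    rw [this]
    have hD : (0 : ℤ) ≤ (y' : ℤ) + ((n : ℤ) + 3) * z' := by positivity
    simp
    nlinarith
  · obtain ⟨k, hk⟩ : ∃ k, z' = z + k := ⟨z' - z, by omega⟩
    have hk1 : 1 ≤ k := by omega
    subst hk
    unfold th Dg Wv
    rw [if_neg (by omega), if_neg (by omega)]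
    set P := Q n ^ z with hP
    have hPpos : 0 < P := Q_pow_pos n z
    have hPQ : Q n ^ (z + k) = P * Q n ^ k := pow_add _ _ _
    rw [hPQ]
    have hQk := mul_Q_le_pow n k hk1
    have hC := choose_two_le n y (by omega)
    have hC' : (0 : ℤ) ≤ ((y'.choose 2 : ℕ) : ℤ) := by positivity
    have hy : (y : ℤ) ≤ n := by exact_mod_cast (show y ≤ n by omega)
    have hy' : (y' : ℤ) ≤ n := by exact_mod_cast (show y' ≤ n by omega)
    have hy1 : (1 : ℤ) ≤ y := by exact_mod_cast h.1
    have hk1' : (1 : ℤ) ≤ k := by exact_mod_cast hk1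
    have hn : (0 : ℤ) ≤ n := by positivity
    have hQ := eight_le_Q n
    -- the polynomial heart: `(n+1)(n + (n+3)k) + 2 + (n+1)² < 2kQ`
    have poly : ((n : ℤ) + 1) * (n + (n + 3) * k) + 2 + ((n : ℤ) + 1) ^ 2 < 2 * (k : ℤ) * Q n := by
      rw [Q_def]; nlinarith [mul_nonneg (sub_nonneg.2 hk1') (by positivity : (0 : ℤ) ≤ 3 * n ^ 2 + 12 * n + 13)]
    -- LHS ≤ P·(n+1)·(n + (n+3)k)
    have hstuff : 0 ≤ ((y' : ℤ) + ((n : ℤ) + 3) * ((z + k : ℕ) : ℤ)) - ((y : ℤ) + ((n : ℤ) + 3) * z) := by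
      push_cast; nlinarith
    have hS1 : ((y' : ℤ) + ((n : ℤ) + 3) * ((z + k : ℕ) : ℤ)) - ((y : ℤ) + ((n : ℤ) + 3) * z) ≤
        (n : ℤ) + (n + 3) * k := by
      push_cast; nlinarith
    have hPy : P * (y : ℤ) - 1 ≤ P * ((n : ℤ) + 1) := by nlinarith
    have lhs : (P * (y : ℤ) - 1) * (((y' : ℤ) + ((n : ℤ) + 3) * ((z + k : ℕ) : ℤ)) - ((y : ℤ) + ((n : ℤ) + 3) * z))
        ≤ P * ((n : ℤ) + 1) * ((n : ℤ) + (n + 3) * k) :=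
      calc (P * (y : ℤ) - 1) * (((y' : ℤ) + ((n : ℤ) + 3) * ((z + k : ℕ) : ℤ)) - ((y : ℤ) + ((n : ℤ) + 3) * z))
          ≤ (P * ((n : ℤ) + 1)) * (((y' : ℤ) + ((n : ℤ) + 3) * ((z + k : ℕ) : ℤ)) - ((y : ℤ) + ((n : ℤ) + 3) * z)) :=
            mul_le_mul_of_nonneg_right hPy hstuff
        _ ≤ (P * ((n : ℤ) + 1)) * ((n : ℤ) + (n + 3) * k) :=
            mul_le_mul_of_nonneg_left hS1 (by positivity)
    have r1 : P * (2 * (k : ℤ) * Q n) ≤ P * (2 * Q n ^ k) :=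
      mul_le_mul_of_nonneg_left (by linarith [hQk]) hPpos.le
    have r2 : P * ((y.choose 2 : ℕ) : ℤ) ≤ P * ((n : ℤ) + 1) ^ 2 := mul_le_mul_of_nonneg_left hC hPpos.le
    have r3 : 0 ≤ P * Q n ^ k * ((y'.choose 2 : ℕ) : ℤ) := by positivity
    have mid := mul_lt_mul_of_pos_left poly hPpos
    nlinarith [lhs, r1, r2, r3, mid]

/-- hull inequality, earlier block (`z' < z`). -/
theorem hull_down (y z y' z' : ℕ) (h : 1 ≤ y ∧ 1 ≤ z ∧ y + z ≤ n + 1)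
    (h' : (y' = 0 ∧ z' = 0) ∨ (1 ≤ y' ∧ 1 ≤ z' ∧ y' + z' ≤ n + 1)) (hzz : z' < z) :
    th n y z * (Dg n y' z' - Dg n y z) < Wv n y' z' - Wv n y z := by
  have hW' := Wv_nonneg n y' z'
  have hy' : (y' : ℤ) ≤ n := by
    rcases h' with ⟨rfl, rfl⟩ | h'
    · positivity
    · exact_mod_cast (show y' ≤ n by omega)
  unfold th Dg
  have hWv : Wv n y z = 2 * Q n ^ z - Q n - 1 + Q n ^ z * ((y.choose 2 : ℕ) : ℤ) := by
    unfold Wv; rw [if_neg (by omega)]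
  rw [hWv]
  set P := Q n ^ z with hP
  have hP8 : 8 ≤ P := by
    have := Q_pow_mono n h.2.1; rw [pow_one] at this; linarith [eight_le_Q n]
  have c1 := two_mul_choose_two y
  have hy1 : (1 : ℤ) ≤ y := by exact_mod_cast h.1
  have hzz' : (z' : ℤ) + 1 ≤ z := by exact_mod_cast hzz
  have hn : (0 : ℤ) ≤ n := by positivity
  have hQ1 := one_le_Q n
  -- `Dg' − Dg ≤ −(y+3)`
  have hD : ((y' : ℤ) + ((n : ℤ) + 3) * z') - ((y : ℤ) + ((n : ℤ) + 3) * z) ≤ -((y : ℤ) + 3) := by nlinarith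
  have hpos : 0 ≤ P * (y : ℤ) - 1 := by nlinarith
  have lhs : (P * (y : ℤ) - 1) * (((y' : ℤ) + ((n : ℤ) + 3) * z') - ((y : ℤ) + ((n : ℤ) + 3) * z)) ≤
      (P * (y : ℤ) - 1) * (-((y : ℤ) + 3)) := mul_le_mul_of_nonneg_left hD hpos
  -- `(Py − 1)(y+3) > 2P + P·C(y,2)`
  have hyy : (0 : ℤ) ≤ (y : ℤ) ^ 2 + 7 * y - 4 := by nlinarith
  have hprod : 0 ≤ (P - 8) * ((y : ℤ) ^ 2 + 7 * y - 4) := mul_nonneg (by linarith) hyy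
  have key : 2 * P + P * ((y.choose 2 : ℕ) : ℤ) < (P * (y : ℤ) - 1) * ((y : ℤ) + 3) := by nlinarith
  nlinarith [lhs, key, hW', hQ1]

/-- **the hull lemma**: at the slope `θ(y,z)` every other admissible point `(y', z')` (or the origin) scores strictly
less than `(y, z)`. -/
theorem hull (y z y' z' : ℕ) (h : (y = 0 ∧ z = 0) ∨ (1 ≤ y ∧ 1 ≤ z ∧ y + z ≤ n + 1))
    (h' : (y' = 0 ∧ z' = 0) ∨ (1 ≤ y' ∧ 1 ≤ z' ∧ y' + z' ≤ n + 1)) (hne : (y, z) ≠ (y', z')) :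
    th n y z * Dg n y' z' - Wv n y' z' < th n y z * Dg n y z - Wv n y z := by
  rcases lt_trichotomy z' z with hlt | heq | hgt
  · have h1 : 1 ≤ y ∧ 1 ≤ z ∧ y + z ≤ n + 1 := by
      rcases h with ⟨rfl, rfl⟩ | h
      · omega
      · exact h
    have := hull_down n y z y' z' h1 h' hlt
    linarith
  · subst heq
    have hz : 1 ≤ z' := by
      rcases h with ⟨rfl, rfl⟩ | h
      · rcases h' with ⟨rfl, _⟩ | h'
        · exact absurd rfl hne
        · omega
      · exact h.2.1
    have hne' : y' ≠ y := fun hy => hne (by rw [hy])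
    have := hull_same n y y' z' hz hne'
    linarith
  · have h1 : 1 ≤ y' ∧ 1 ≤ z' ∧ y' + z' ≤ n + 1 := by
      rcases h' with ⟨rfl, rfl⟩ | h'
      · omega
      · exact h'
    have := hull_up n y z y' z' h h1 hgt
    linarith

/-- the non-strict form (equality allowed only at the point itself). -/
theorem hull_le (y z y' z' : ℕ) (h : (y = 0 ∧ z = 0) ∨ (1 ≤ y ∧ 1 ≤ z ∧ y + z ≤ n + 1))
    (h' : (y' = 0 ∧ z' = 0) ∨ (1 ≤ y' ∧ 1 ≤ z' ∧ y' + z' ≤ n + 1)) :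
    th n y z * Dg n y' z' - Wv n y' z' ≤ th n y z * Dg n y z - Wv n y z := by
  by_cases hne : (y, z) = (y', z')
  · obtain ⟨rfl, rfl⟩ := Prod.mk.inj hne
    exact le_rfl
  · exact (hull n y z y' z' h h' hne).le

/-- the landing set has `aexc σ` elements. -/
theorem land_card (σ : Equiv.Perm (Fin (n + 1))) : (land n σ).card = aexc n σ := by
  unfold land aexc
  apply Finset.card_image_of_injective
  intro a b h
  exact σ.injective (Fin.ext h)

/-- membership in the landing set. -/
theorem mem_land (σ : Equiv.Perm (Fin (n + 1))) (a : ℕ) :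
    a ∈ land n σ ↔ ∃ i : Fin (n + 1), ((σ i : Fin (n + 1)) : ℕ) = a ∧ ((σ i : Fin (n + 1)) : ℕ) < (i : ℕ) := by
  unfold land
  rw [Finset.mem_image]
  constructor
  · rintro ⟨i, hi, rfl⟩
    rw [Finset.mem_filter] at hi
    exact ⟨i, rfl, hi.2⟩
  · rintro ⟨i, hi, hlt⟩
    exact ⟨i, Finset.mem_filter.mpr ⟨Finset.mem_univ _, hlt⟩, hi⟩

/-- the row `σ 0` is never a landing row. -/
theorem sigma_zero_not_mem_land (σ : Equiv.Perm (Fin (n + 1))) : ((σ 0 : Fin (n + 1)) : ℕ) ∉ land n σ := by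
  rw [mem_land]
  rintro ⟨i, hi, hlt⟩
  have h0 : i = 0 := σ.injective (Fin.ext hi)
  rw [h0] at hlt
  exact Nat.not_lt_zero _ hlt

/-- `a ↦ Q^a (Q − 1)` is monotone. -/
theorem beta_mono : Monotone (fun a : ℕ => Q n ^ a * (Q n - 1)) := by
  intro a b hab
  have h1 : 0 ≤ Q n - 1 := by linarith [one_le_Q n]
  exact mul_le_mul_of_nonneg_right (Q_pow_mono n hab) h1

/-- **cost lower bound**: column `0` plus `Q^a (Q − 1)` for every landing row `a`. -/
theorem cost_ge_land (σ : Equiv.Perm (Fin (n + 1))) :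
    c0 n σ + ∑ a ∈ land n σ, Q n ^ a * (Q n - 1) ≤ cost n σ := by
  rw [cost_eq]
  unfold land
  rw [Finset.sum_image (fun a _ b _ h => σ.injective (Fin.ext h))]
  have : ∑ x ∈ univ.filter (fun i : Fin (n + 1) => ((σ i : Fin (n + 1)) : ℕ) < (i : ℕ)),
      Q n ^ ((σ x : Fin (n + 1)) : ℕ) * (Q n - 1) ≤
      ∑ i ∈ univ.filter (fun i : Fin (n + 1) => ((σ i : Fin (n + 1)) : ℕ) < (i : ℕ)), val n (σ i) i := by
    apply Finset.sum_le_sum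
    intro i hi
    rw [Finset.mem_filter] at hi
    exact val_upper_ge n _ _ hi.2
  linarith

/-- case `σ 0 > z`: `(Q^(z+1) − Q) + (Q^z − 1)` beats every `W(y, z)`. -/
theorem boundA (y z : ℕ) (hz : 1 ≤ z) (hy : y ≤ n + 1) :
    Wv n y z < (Q n ^ (z + 1) - Q n) + (Q n ^ z - 1) := by
  unfold Wv; rw [if_neg (by omega)]
  have hC := choose_two_add_le_Q n y hy
  have hP := Q_pow_pos n z
  have hn : (0 : ℤ) ≤ n := by positivity
  rw [pow_succ]
  nlinarith [mul_pos hP (show (0 : ℤ) < Q n - 1 - ((y.choose 2 : ℕ) : ℤ) by linarith)]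

/-- case «landing rows ≠ {0,…,z−1}»: `(Q^(z−1) − 1) + Q^z (Q − 1)` beats every `W(y, z)`. -/
theorem boundB (y z : ℕ) (hz : 1 ≤ z) (hy : y ≤ n + 1) :
    Wv n y z < (Q n ^ (z - 1) - 1) + Q n ^ z * (Q n - 1) := by
  unfold Wv; rw [if_neg (by omega)]
  obtain ⟨z', rfl⟩ : ∃ z', z = z' + 1 := ⟨z - 1, by omega⟩
  rw [show z' + 1 - 1 = z' by omega, pow_succ]
  have hC := choose_two_add_le_Q n y hy
  have hP := Q_pow_pos n z'
  have hQ := eight_le_Q n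
  have hn : (0 : ℤ) ≤ n := by positivity
  nlinarith [mul_nonneg (mul_nonneg hP.le (Q_pos n).le)
    (show (0 : ℤ) ≤ Q n - 3 - ((y.choose 2 : ℕ) : ℤ) by linarith)]

end Mountain

end Summit.ValiantsHypothesis.ValiantsHypothesis.Theorems.LacunarySymmetroidMatrixDescartes.TropicalCensus
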